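import Summits.Ventures.YMGap.RobustBall.IndexedMember
import HarnessLib

/-!
# Venture YMGap, track ROBUST-BALL (tier 1) — indexed families of FINITE-RANGE terms are members of the `ℤ^d` ball
# `MemBallZd`

HONEST FRAMING. WHAT THIS IS: a venture file (cell `pub-ymgap`, track Y2 ROBUST-BALL, seat rb-p1), the tier-1 twin of
`IndexedMember.lean`: for a family of terms `φ_i` carried by finite link sets `code i` with finite carrier fibres
(`fib`), FINITELY MANY TERMS THROUGH EVERY LINK (`throughFib`, from `{i | e ∈ code i}.Finite`) and carriers of
`ℓ^∞`-extent `≤ R`, the indexed potential `indexedPotential fib φ` with the support family `indexedSupp code`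
(carriers of the terms through the links of a volume) is a member of rb-p1's tier-1 ball
`MemBallZd ε₀ ε₁ R W supp` (`MassGapOnBall.lean`) as soon as the per-link FINITE sums obey
`∑_{i ∋ e} o_i(e) ≤ ε₀` and `∑_{i ∋ e} ∑_{y ∈ code i ∖ e} l_i(y) ≤ ε₁` (`memBallZd_indexed`). The only mathematics is
fibre bookkeeping (finite sums). WHAT IT IS NOT: no measure, no estimate on a Gibbs state, no number; nothing about
the continuum limit or the Clay problem.

References: H.-O. Georgii, *Gibbs Measures and Phase Transitions* (2011), (2.11) (supported potentials); the ball is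
this track's (`MassGapOnBall.lean`).
-/

noncomputable section

open MeasureTheory Filter Function Topology Real
open Literature.Probability.LatticeModels
open Literature.Probability.LatticeModels.DobrushinMetric
open Literature.MathematicalPhysics.QuantumLattice
open Literature.MathematicalPhysics.QuantumFieldTheory hiding ZdEdge Site

namespace Summit.Ventures.YMGap.RobustBall

variable {d N : ℕ} {ι : Type*}

/-! ### Terms through a link; the support family -/

section Supp

variable {code : ι → Finset (ZdEdge d)}

open Classical in
/-- The indices whose carrier contains the link `e`, as a finite set (junk `∅` when there are infinitely many; see
`mem_throughFib`). -/
def throughFib (code : ι → Finset (ZdEdge d)) (e : ZdEdge d) : Finset ι :=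
  if h : {i | e ∈ code i}.Finite then h.toFinset else ∅

/-- With finitely many terms through every link, `throughFib code e` is exactly the set of terms through `e`. -/
theorem mem_throughFib (hthr : ∀ e, {i | e ∈ code i}.Finite) (e : ZdEdge d) (i : ι) :
    i ∈ throughFib code e ↔ e ∈ code i := by
  unfold throughFib
  rw [dif_pos (hthr e), Set.Finite.mem_toFinset]
  rfl

open Classical in
/-- **The support family of an indexed potential**: for a volume `Λ`, the carriers of the terms through the links
of `Λ`. -/
def indexedSupp (code : ι → Finset (ZdEdge d)) (Λ : Finset (ZdEdge d)) : Finset (Finset (ZdEdge d)) :=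
  (Λ.biUnion (throughFib code)).image code

/-- Membership in the support family. -/
theorem mem_indexedSupp_iff (hthr : ∀ e, {i | e ∈ code i}.Finite) {Λ X : Finset (ZdEdge d)} :
    X ∈ indexedSupp code Λ ↔ ∃ i, code i = X ∧ ∃ e ∈ Λ, e ∈ code i := by
  classical
  unfold indexedSupp
  simp only [Finset.mem_image, Finset.mem_biUnion, mem_throughFib hthr]
  constructor
  · rintro ⟨i, ⟨e, he, hei⟩, rfl⟩
    exact ⟨i, rfl, e, he, hei⟩
  · rintro ⟨i, rfl, e, he, hei⟩
    exact ⟨i, ⟨e, he, hei⟩, rfl⟩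

/-- The sets of the support family through `e` containing `e` are the carriers of the terms through `e`. -/
theorem mem_filter_indexedSupp_singleton_iff (hthr : ∀ e, {i | e ∈ code i}.Finite) {e : ZdEdge d}
    {X : Finset (ZdEdge d)} :
    X ∈ (indexedSupp code {e}).filter (fun X => e ∈ X) ↔ ∃ i, code i = X ∧ e ∈ code i := by
  rw [Finset.mem_filter, mem_indexedSupp_iff hthr]
  constructor
  · rintro ⟨⟨i, rfl, e', he', hei⟩, heX⟩
    exact ⟨i, rfl, heX⟩
  · rintro ⟨i, rfl, hei⟩
    exact ⟨⟨i, rfl, e, Finset.mem_singleton_self e, hei⟩, hei⟩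

variable {fib : Finset (ZdEdge d) → Finset ι}

/-- **Fibre sums over the support family through `e` are sums over the terms through `e`.** -/
theorem sum_filter_indexedSupp_sum_fib_eq [DecidableEq ι] (hfib : ∀ X i, i ∈ fib X ↔ code i = X)
    (hthr : ∀ e, {i | e ∈ code i}.Finite) (e : ZdEdge d) (g : ι → ℝ) :
    ∑ X ∈ (indexedSupp code {e}).filter (fun X => e ∈ X), ∑ i ∈ fib X, g i = ∑ i ∈ throughFib code e, g i := by
  rw [sum_sum_fib_eq hfib]
  refine Finset.sum_congr ?_ fun _ _ => rfl
  ext i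
  simp only [Finset.mem_biUnion, mem_filter_indexedSupp_singleton_iff hthr, hfib, mem_throughFib hthr]
  constructor
  · rintro ⟨X, ⟨j, rfl, hej⟩, hij⟩
    rw [hij]; exact hej
  · intro hei
    exact ⟨code i, ⟨i, rfl, hei⟩, rfl⟩

variable {φ : ι → LGConfig d (Matrix.specialUnitaryGroup (Fin N) ℂ) → ℝ}

/-- **The indexed potential is supported by its support family**: a link set meeting `Λ` and carrying a nonzero
term is the carrier of a term through a link of `Λ`. -/
theorem isSupportedBy_indexedPotential (hfib : ∀ X i, i ∈ fib X ↔ code i = X)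
    (hthr : ∀ e, {i | e ∈ code i}.Finite) : (indexedPotential fib φ).IsSupportedBy (indexedSupp code) := by
  intro Λ X hXΛ hne
  have hfX : (fib X).Nonempty := by
    by_contra h
    rw [Finset.not_nonempty_iff_eq_empty] at h
    exact hne (funext fun U => by simp [indexedPotential_apply, h])
  obtain ⟨i, hi⟩ := hfX
  have hci : code i = X := (hfib X i).1 hi
  obtain ⟨e, he⟩ := hXΛ
  rw [Finset.mem_inter] at he
  exact (mem_indexedSupp_iff hthr).2 ⟨i, hci, e, he.2, hci ▸ he.1⟩

end Supp

/-! ### Membership in the tier-1 ball -/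

section Member

variable {code : ι → Finset (ZdEdge d)} {fib : Finset (ZdEdge d) → Finset ι}
  {φ : ι → LGConfig d (Matrix.specialUnitaryGroup (Fin N) ℂ) → ℝ}

/-- **Indexed families of finite-range terms with finitely many terms through every link are members of the
tier-1 ball.** If every term `φ_i` is continuous and depends on its carrier `code i`, has oscillation witnesses
`o_i` and Frobenius–Lipschitz witnesses `l_i` VANISHING OFF THE CARRIER, carriers have `ℓ^∞`-extent `≤ R`, and
through every link `e` the finite sums obey `∑_{i ∋ e} o_i(e) ≤ ε₀`, `∑_{i ∋ e} ∑_{y ∈ code i ∖ e} l_i(y) ≤ ε₁`, then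
`(indexedPotential fib φ, indexedSupp code) ∈ MemBallZd ε₀ ε₁ R`. -/
theorem memBallZd_indexed (hfib : ∀ X i, i ∈ fib X ↔ code i = X) (hthr : ∀ e, {i | e ∈ code i}.Finite)
    (hcont : ∀ i, Continuous (φ i)) (hdep : ∀ i, DependsOn (φ i) (↑(code i) : Set (ZdEdge d)))
    {o l : ι → ZdEdge d → ℝ} (ho : ∀ i, Dobrushin.IsOscBound (φ i) (o i))
    (hl : ∀ i, IsLipBound suFrobDist (φ i) (l i)) (hl0 : ∀ i y, y ∉ code i → l i y = 0) {ε₀ ε₁ R : ℝ}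
    (hR : ∀ i, ∀ e ∈ code i, ∀ y ∈ code i, ‖e.1 - y.1‖ ≤ R)
    (hosc : ∀ e, ∑ i ∈ throughFib code e, o i e ≤ ε₀)
    (hlip : ∀ e, ∑ i ∈ throughFib code e, ∑ y ∈ (code i).erase e, l i y ≤ ε₁) :
    MemBallZd ε₀ ε₁ R (indexedPotential fib φ) (indexedSupp code) := by
  haveI : DecidableEq ι := Classical.decEq ι
  have hcont' : ∀ X, Continuous (indexedPotential fib φ X) := fun X => by
    change Continuous fun U => ∑ i ∈ fib X, φ i U
    exact continuous_finsetSum _ fun i _ => hcont i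
  have hrange : ∀ e, ∀ X ∈ indexedSupp code {e}, e ∈ X → ∀ y ∈ X, ‖e.1 - y.1‖ ≤ R := by
    intro e X hX he y hy
    obtain ⟨i, rfl, -⟩ := (mem_indexedSupp_iff hthr).1 hX
    exact hR i e he y hy
  have hoscL : ∀ e, ∑ X ∈ (indexedSupp code {e}).filter (fun X => e ∈ X), ∑ i ∈ fib X, o i e ≤ ε₀ := by
    intro e
    rw [sum_filter_indexedSupp_sum_fib_eq hfib hthr]
    exact hosc e
  have hl00 : ∀ i y, 0 ≤ l i y := fun i y => (hl i).nonneg y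
  have hlipL : ∀ e, ∑ y ∈ perturbedNbr (indexedSupp code) e,
      ∑ X ∈ (indexedSupp code {e}).filter (fun X => e ∈ X), ∑ i ∈ fib X, l i y ≤ ε₁ := by
    intro e
    have hinner : ∀ y ∈ perturbedNbr (indexedSupp code) e,
        ∑ X ∈ (indexedSupp code {e}).filter (fun X => e ∈ X), ∑ i ∈ fib X, l i y =
          ∑ i ∈ throughFib code e, l i y :=
      fun y _ => sum_filter_indexedSupp_sum_fib_eq hfib hthr e fun i => l i y
    rw [Finset.sum_congr rfl hinner, Finset.sum_comm]
    refine (Finset.sum_le_sum fun i _ => ?_).trans (hlip e)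
    -- for one term: the neighbourhood sum sees only the carrier minus `e`
    rw [← Finset.sum_filter_of_ne (p := fun y => y ∈ code i) (fun y _ hne => by
      by_contra hy; exact hne (hl0 i y hy))]
    refine Finset.sum_le_sum_of_subset_of_nonneg (fun y hy => ?_) fun y _ _ => hl00 i y
    rw [Finset.mem_filter] at hy
    refine Finset.mem_erase.2 ⟨fun hye => ?_, hy.2⟩
    have hy1 := hy.1
    rw [hye] at hy1
    exact not_mem_perturbedNbr (indexedSupp code) e hy1
  exact MemBallZd.mk hcont' (dependsOn_indexedPotential hfib hdep) (isSupportedBy_indexedPotential hfib hthr) hrange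
    ⟨fun X y => ∑ i ∈ fib X, o i y, fun X y => ∑ i ∈ fib X, l i y, fun X => isOscBound_indexedPotential ho X,
      fun X => isLipBound_indexedPotential hl X, hoscL, hlipL⟩

end Member

end Summit.Ventures.YMGap.RobustBall

end
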